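import Summits.NavierStokesRegularity.NavierStokesRegularity.Theorems.SoloRefuteSchatz2025WindJetFlow

/-!
# C171 `Schatz2025` — wind-jet refutation of the local face `Step_M1_local` — part 3/6: the column functional

Cell `ns-claims` (D-0090), row C171 `Schatz2025` (locator =
the LANDED skeleton `Literature.Claims.NS.Schatz2025`, text of record as cited in its module docstring). Records-grade ADDENDUM
object of ns-claims-refuter-5 g5 (chair 2026-08-27T18:19Z: records only; row #155 adjudicated at the consumed
head `Step_M1`). Target of the chain: the RECORDED local face
`Literature.Claims.NS.Schatz2025.Step_M1_local` (skeleton l.182; (M.1) p.42 l.2, l.36–38 «F(θr) ≤ κ F(r) + C θ³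
for every suitable weak solution on Q_r(z0)», constants `θ ∈ (0,1/8)`, `κ ∈ (0,1)`, `C ≥ 0` FIRST, then every
open region, every suitable weak solution, every centre and radius with `Q_{2r}(z0) ⊆ Q`).
Main theorem (last file of the chain): `Summit.NavierStokesRegularity.NavierStokesRegularity.Theorems.Schatz2025.not_Step_M1_local`.

THIS FILE (3/6): the column functional `Gcol` (defined in part 2; zero before birth), its
planar integrals over discs (exact cube mass, far-field bound `Gcol ≤ (π w'²)⁻³` off the column), and the
chord integrals `∫ chord` of the unit ball over the moving disc (lower bound on the window `|t| ≤ (θ−w)/U`,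
upper bound `π/2 + 2w'` per unit speed).

WHAT THIS IS NOT: not a claim about NS regularity or blow-up; not a claim about any author beyond the typed
locator.
-/

-- lint debt (cell convention, SoloRefute files): the Theorems namespace repeats `NavierStokesRegularity`.
set_option linter.dupNamespace false

noncomputable section

open Set Function MeasureTheory Filter TopologicalSpace Metric Real
open scoped Topology ContDiff ENNReal RealInnerProductSpace Laplacian

namespace Summit.NavierStokesRegularity.NavierStokesRegularity.Theorems.Schatz2025

open Literature.Analysis.FluidPDE Literature.Analysis.UnboundedOperators


/-! ## C2. The cubed jet profile as a column density; disc masses; pointwise bounds; time integrals -/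

/-- The column functional `Gcol a U` is measurable on `ℝ × (EuclideanSpace ℝ (Fin 2))`. [folklore] -/
theorem measurable_Gcol (a U t : ℝ) : Measurable (Gcol a U t) := by
  have h : Measurable fun y : (EuclideanSpace ℝ (Fin 2)) => heatKernelFwd (E := (EuclideanSpace ℝ (Fin 2))) 1 (t + a, y - t • windV U) :=
    measurable_heatKernelFwd.comp (by fun_prop)
  exact (h.pow_const 3).ennreal_ofReal

/-- The column functional composed with `projXY` is measurable on `ℝ × (EuclideanSpace ℝ (Fin 3))`. [folklore] -/
theorem measurable_Gcol_proj (a U : ℝ) :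
    Measurable fun q : ℝ × (EuclideanSpace ℝ (Fin 3)) => Gcol a U q.1 (projXY q.2) := by
  have h : Measurable fun q : ℝ × (EuclideanSpace ℝ (Fin 3)) =>
      heatKernelFwd (E := (EuclideanSpace ℝ (Fin 2))) 1 (q.1 + a, projXY q.2 - q.1 • windV U) :=
    measurable_heatKernelFwd.comp (by fun_prop)
  exact (h.pow_const 3).ennreal_ofReal

/-- Before birth the column functional vanishes. [folklore] -/
theorem Gcol_eq_zero_of_nonpos {a U t : ℝ} (ht : t + a ≤ 0) (y : (EuclideanSpace ℝ (Fin 2))) : Gcol a U t y = 0 := by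
  rw [Gcol, heatKernelFwd_of_nonpos 1 (by exact ht)]
  simp

/-- The disc mass of the column density, translated to the origin. [folklore] -/
theorem lintegral_Gcol_ball (a U t w : ℝ) :
    ∫⁻ y in ball (t • windV U) w, Gcol a U t y =
      ∫⁻ η in ball (0 : (EuclideanSpace ℝ (Fin 2))) w, ENNReal.ofReal (heatKernelFwd 1 (t + a, η) ^ 3) :=
  lintegral_ball_sub (fun η => ENNReal.ofReal (heatKernelFwd 1 (t + a, η) ^ 3)) (t • windV U) w

/-- After birth, the planar `lintegral` of the column functional over a disc centred on the column is the cube mass of `K_{t+a}` over the centred disc. [folklore] -/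
theorem lintegral_Gcol_ball_of_pos {a U t : ℝ} (ht : 0 < t + a) (w : ℝ) :
    ∫⁻ y in ball (t • windV U) w, Gcol a U t y =
      ENNReal.ofReal (∫ η in ball (0 : (EuclideanSpace ℝ (Fin 2))) w, heatKernel (t + a) η ^ 3) := by
  rw [lintegral_Gcol_ball]
  have h : ∀ η : (EuclideanSpace ℝ (Fin 2)), heatKernelFwd 1 (t + a, η) = heatKernel (t + a) η := fun η => by
    rw [heatKernelFwd_of_pos 1 (by exact ht), one_mul]
  simp_rw [h]
  rw [ofReal_integral_eq_lintegral_ofReal (integrable_heatKernel_cube ht).integrableOn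
    (Eventually.of_forall fun η => pow_nonneg (heatKernel_pos ht η).le 3)]

/-- **Lower disc mass** for a young jet (`0 < t + a ≤ a`). [folklore] -/
theorem lintegral_Gcol_ball_ge {a U t w : ℝ} (ht : 0 < t + a) (ht0 : t ≤ 0) (hw : 0 ≤ w)
    (htail : 2 * exp (-(3 * w ^ 2) / (8 * a)) ≤ 1) :
    ENNReal.ofReal ((48 * π ^ 2 * a ^ 2)⁻¹ * (1 - 2 * exp (-(3 * w ^ 2) / (8 * a)))) ≤
      ∫⁻ y in ball (t • windV U) w, Gcol a U t y := by
  rw [lintegral_Gcol_ball_of_pos ht]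
  refine ENNReal.ofReal_le_ofReal (le_trans ?_ (integral_heatKernel_cube_ball_ge ht hw))
  have hτa : t + a ≤ a := by linarith
  have h1 : (48 * π ^ 2 * a ^ 2)⁻¹ ≤ (48 * π ^ 2 * (t + a) ^ 2)⁻¹ :=
    inv_anti₀ (by positivity)
      (mul_le_mul_of_nonneg_left (pow_le_pow_left₀ ht.le hτa 2) (by positivity))
  have h2 : 2 * exp (-(3 * w ^ 2) / (8 * (t + a))) ≤ 2 * exp (-(3 * w ^ 2) / (8 * a)) := by
    refine mul_le_mul_of_nonneg_left (Real.exp_le_exp.2 ?_) two_pos.le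
    rw [neg_div, neg_div, neg_le_neg_iff]
    exact div_le_div_of_nonneg_left (by positivity) (by positivity) (by linarith)
  exact mul_le_mul h1 (by linarith) (by linarith) (by positivity)

/-- **Upper disc mass** for an old jet (`t + a ≥ a₂ > 0`). [folklore] -/
theorem lintegral_Gcol_ball_le {a U t a₂ : ℝ} (ha₂ : 0 < a₂) (ht : a₂ ≤ t + a) (w : ℝ) :
    ∫⁻ y in ball (t • windV U) w, Gcol a U t y ≤ ENNReal.ofReal ((48 * π ^ 2 * a₂ ^ 2)⁻¹) := by
  have ht' : 0 < t + a := by linarith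
  rw [lintegral_Gcol_ball_of_pos ht']
  refine ENNReal.ofReal_le_ofReal ((setIntegral_heatKernel_cube_le ht' _).trans ?_)
  exact inv_anti₀ (by positivity)
    (mul_le_mul_of_nonneg_left (pow_le_pow_left₀ ha₂.le ht 2) (by positivity))

/-- `‖t • windV U‖ = |t| |U|`. [folklore] -/
theorem norm_time_smul_windV {U t : ℝ} (hU : 0 < U) (ht : t ≤ 0) : ‖t • windV U‖ = -t * U := by
  rw [norm_smul, norm_windV, Real.norm_eq_abs, abs_of_nonpos ht, abs_of_pos hU]

/-- **Pointwise bound on `Q₁`**: the profile is at most `1/a` (far from the axis `K ≤ 1/(π d²) ≤ 1/π`; near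
the axis the jet is old, `K ≤ 1/(4π(t+a)) ≤ 1/(2πa)`). [folklore] -/
theorem heatKernelFwd_col_le {a U t : ℝ} (ha : 0 < a) (ha1 : a ≤ 1) (hU : 0 < U) (haU : 4 ≤ a * U)
    (ht : t < 0) {y : (EuclideanSpace ℝ (Fin 2))} (hy : ‖y‖ < 1) :
    heatKernelFwd 1 (t + a, y - t • windV U) ≤ a⁻¹ := by
  rcases le_or_gt (t + a) 0 with hta | hta
  · rw [heatKernelFwd_of_nonpos 1 (by exact hta)]; positivity
  rw [heatKernelFwd_of_pos 1 (by exact hta), one_mul]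
  have hπ := Real.pi_gt_three
  have htV : ‖t • windV U‖ = -t * U := norm_time_smul_windV hU ht.le
  rcases le_or_gt 2 (-t * U) with hfar | hnear
  · have hn : 1 ≤ ‖y - t • windV U‖ := by
      have h1 := norm_sub_norm_le (t • windV U) y
      rw [norm_sub_rev] at h1
      linarith
    have hne : y - t • windV U ≠ 0 := by
      intro h; rw [h, norm_zero] at hn; linarith
    calc heatKernel (t + a) (y - t • windV U) ≤ (π * ‖y - t • windV U‖ ^ 2)⁻¹ :=
          heatKernel_le_inv_norm_sq hta hne
      _ ≤ a⁻¹ := by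
          apply inv_anti₀ ha
          have : 1 ≤ ‖y - t • windV U‖ ^ 2 := by nlinarith
          nlinarith
  · have h2 : -t ≤ a / 2 := by
      by_contra hcon
      rw [not_le] at hcon
      nlinarith [mul_lt_mul_of_pos_right hcon hU]
    calc heatKernel (t + a) (y - t • windV U) ≤ (4 * π * (t + a))⁻¹ := heatKernel_le_inv_time hta _
      _ ≤ a⁻¹ := by
          apply inv_anti₀ ha
          nlinarith

/-- **Far-field bound**: at horizontal distance `≥ w` from the axis the profile is `≤ (π w²)⁻¹`. [folklore] -/
theorem heatKernelFwd_col_le_far {a U t w : ℝ} (hw : 0 < w) {y : (EuclideanSpace ℝ (Fin 2))} (hy : w ≤ ‖y - t • windV U‖) :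
    heatKernelFwd 1 (t + a, y - t • windV U) ≤ (π * w ^ 2)⁻¹ := by
  rcases le_or_gt (t + a) 0 with hta | hta
  · rw [heatKernelFwd_of_nonpos 1 (by exact hta)]; positivity
  rw [heatKernelFwd_of_pos 1 (by exact hta), one_mul]
  have hne : y - t • windV U ≠ 0 := by
    intro h; rw [h, norm_zero] at hy; linarith
  calc heatKernel (t + a) (y - t • windV U) ≤ (π * ‖y - t • windV U‖ ^ 2)⁻¹ :=
        heatKernel_le_inv_norm_sq hta hne
    _ ≤ (π * w ^ 2)⁻¹ := by
        apply inv_anti₀ (by positivity)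
        exact mul_le_mul_of_nonneg_left (pow_le_pow_left₀ hw.le hy 2) (by positivity)

/-- Off the column (distance `≥ w'` from its centre) the column functional is at most `(π w'²)⁻³`. [folklore] -/
theorem Gcol_le_far {a U t w : ℝ} (hw : 0 < w) {y : (EuclideanSpace ℝ (Fin 2))} (hy : y ∉ ball (t • windV U) w) :
    Gcol a U t y ≤ ENNReal.ofReal ((π * w ^ 2)⁻¹ ^ 3) := by
  have hy' : w ≤ ‖y - t • windV U‖ := by rwa [mem_ball, dist_eq_norm, not_lt] at hy
  exact ENNReal.ofReal_le_ofReal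
    (pow_le_pow_left₀ (heatKernelFwd_nonneg' _) (heatKernelFwd_col_le_far hw hy') 3)

/-! ### The two time integrals of the chord factor -/

/-- `∫₀¹ √(1 − x²) dx = π/4`. [folklore] -/
theorem integral_sqrt_one_sub_sq_half : ∫ x in (0:ℝ)..1, √(1 - x ^ 2) = π / 4 := by
  have h1 : ∫ x in (0:ℝ)..1, √(1 - x ^ 2) = ∫ x in (-1:ℝ)..0, √(1 - x ^ 2) := by
    have := intervalIntegral.integral_comp_neg (a := 0) (b := 1) (fun x : ℝ => √(1 - x ^ 2))
    simpa only [neg_sq, neg_zero] using this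
  have hc : Continuous fun x : ℝ => √(1 - x ^ 2) := by fun_prop
  have h2 := intervalIntegral.integral_add_adjacent_intervals (hc.intervalIntegrable (μ := volume) (-1) 0)
    (hc.intervalIntegrable (μ := volume) 0 1)
  rw [integral_sqrt_one_sub_sq] at h2
  linarith

/-- `∫₀^θ 2√(θ² − s²) ds = πθ²/2` (area of a half disc). [folklore] -/
theorem integral_chord_full {θ : ℝ} (hθ : 0 < θ) :
    ∫ s in (0:ℝ)..θ, 2 * √(θ ^ 2 - s ^ 2) = π * θ ^ 2 / 2 := by
  have h := intervalIntegral.integral_comp_mul_left (a := 0) (b := 1)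
    (fun s => 2 * √(θ ^ 2 - s ^ 2)) hθ.ne'
  simp only [mul_zero, mul_one] at h
  have h2 : ∀ x : ℝ, 2 * √(θ ^ 2 - (θ * x) ^ 2) = 2 * θ * √(1 - x ^ 2) := by
    intro x
    rw [show θ ^ 2 - (θ * x) ^ 2 = θ ^ 2 * (1 - x ^ 2) by ring, Real.sqrt_mul (sq_nonneg θ),
      Real.sqrt_sq hθ.le]
    ring
  simp_rw [h2] at h
  rw [intervalIntegral.integral_const_mul, integral_sqrt_one_sub_sq_half, smul_eq_mul] at h
  have h3 : ∫ s in (0:ℝ)..θ, 2 * √(θ ^ 2 - s ^ 2) = θ * (2 * θ * (π / 4)) := by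
    rw [h, ← mul_assoc, mul_inv_cancel₀ hθ.ne', one_mul]
  rw [h3]
  ring

/-- `∫₀^w 2√(θ² − s²) ds ≤ 2θw`. [folklore] -/
theorem integral_chord_head_le {θ w : ℝ} (hθ : 0 < θ) (hw : 0 ≤ w) :
    ∫ s in (0:ℝ)..w, 2 * √(θ ^ 2 - s ^ 2) ≤ 2 * θ * w := by
  have hc : Continuous fun s : ℝ => 2 * √(θ ^ 2 - s ^ 2) := by fun_prop
  calc ∫ s in (0:ℝ)..w, 2 * √(θ ^ 2 - s ^ 2) ≤ ∫ _ in (0:ℝ)..w, 2 * θ :=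
        intervalIntegral.integral_mono_on hw (hc.intervalIntegrable 0 w) intervalIntegrable_const
          fun s _ => by
            have : √(θ ^ 2 - s ^ 2) ≤ √(θ ^ 2) := Real.sqrt_le_sqrt (by nlinarith)
            rw [Real.sqrt_sq hθ.le] at this
            linarith
    _ = 2 * θ * w := by rw [intervalIntegral.integral_const, smul_eq_mul]; ring

/-- **Lower time integral.** Over the window `(−(θ−w)/U, 0)` the chord factor of the thin column integrates to
at least `(πθ²/2 − 2θw)/U`. [folklore] -/
theorem lintegral_chord_low {θ w U : ℝ} (hθ : 0 < θ) (hw : 0 ≤ w) (hU : 0 < U) :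
    ENNReal.ofReal ((π * θ ^ 2 / 2 - 2 * θ * w) / U) ≤
      ∫⁻ t in Ioo (-(θ - w) / U) 0, ENNReal.ofReal (2 * √(θ ^ 2 - (‖t • windV U‖ + w) ^ 2)) := by
  set A : ℝ := -(θ - w) / U with hA
  set f : ℝ → ℝ := fun s => 2 * √(θ ^ 2 - s ^ 2) with hf
  have hfc : Continuous f := by rw [hf]; fun_prop
  rcases le_or_gt 0 A with hA0 | hA0
  · -- degenerate window (`w ≥ θ`): the claimed lower bound is nonpositive
    have hwθ : θ ≤ w := by
      have : -(θ - w) / U * U = -(θ - w) := by field_simp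
      nlinarith [div_nonneg_iff.1 hA0]
    have : (π * θ ^ 2 / 2 - 2 * θ * w) / U ≤ 0 := by
      apply div_nonpos_of_nonpos_of_nonneg _ hU.le
      nlinarith [Real.pi_lt_four, mul_le_mul_of_nonneg_left hwθ hθ.le]
    rw [ENNReal.ofReal_of_nonpos this]
    exact bot_le
  have hwin : EqOn (fun t => ENNReal.ofReal (2 * √(θ ^ 2 - (‖t • windV U‖ + w) ^ 2)))
      (fun t => ENNReal.ofReal (f (w - U * t))) (Ioo A 0) := by
    intro t ht
    simp only [hf, norm_time_smul_windV hU ht.2.le]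
    congr 3
    ring
  rw [setLIntegral_congr_fun measurableSet_Ioo hwin]
  have hgc : Continuous fun t => f (w - U * t) := hfc.comp (by fun_prop)
  have hint : IntegrableOn (fun t => f (w - U * t)) (Ioo A 0) :=
    (hgc.continuousOn.integrableOn_Icc).mono_set Ioo_subset_Icc_self
  have hnn : 0 ≤ᵐ[volume.restrict (Ioo A 0)] fun t => f (w - U * t) :=
    Eventually.of_forall fun t => by simp only [hf]; positivity
  rw [← ofReal_integral_eq_lintegral_ofReal hint hnn]
  refine ENNReal.ofReal_le_ofReal ?_
  rw [← integral_Ioc_eq_integral_Ioo, ← intervalIntegral.integral_of_le hA0.le,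
    intervalIntegral.integral_comp_sub_mul f hU.ne' w]
  have hlim1 : w - U * 0 = w := by ring
  have hlim2 : w - U * A = θ := by rw [hA]; field_simp; ring
  rw [hlim1, hlim2, smul_eq_mul]
  have hsplit := intervalIntegral.integral_add_adjacent_intervals
    (hfc.intervalIntegrable (μ := volume) 0 w) (hfc.intervalIntegrable (μ := volume) w θ)
  have hfull : ∫ s in (0:ℝ)..θ, f s = π * θ ^ 2 / 2 := integral_chord_full hθ
  have hhead : ∫ s in (0:ℝ)..w, f s ≤ 2 * θ * w := integral_chord_head_le hθ hw
  rw [div_eq_inv_mul]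
  exact mul_le_mul_of_nonneg_left (by linarith) (inv_nonneg.2 hU.le)

/-- **Upper time integral.** Over `(−1, 0)` the chord factor of the fat column integrates to at most
`(π/2 + 2w')/U`. [folklore] -/
theorem lintegral_chord_up {w' U : ℝ} (hw : 0 ≤ w') (hU : 0 < U) :
    ∫⁻ t in Ioo (-1:ℝ) 0, ENNReal.ofReal (2 * √(1 ^ 2 - (max (‖t • windV U‖ - w') 0) ^ 2)) ≤
      ENNReal.ofReal ((π / 2 + 2 * w') / U) := by
  set F : ℝ → ℝ≥0∞ := fun t => ENNReal.ofReal (2 * √(1 ^ 2 - (max (‖t • windV U‖ - w') 0) ^ 2))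
    with hF
  set A : ℝ := -(1 + w') / U with hA
  set B : ℝ := -w' / U with hB
  have hAB : A ≤ B := by rw [hA, hB]; exact div_le_div_of_nonneg_right (by linarith) hU.le
  have hB0 : B ≤ 0 := by rw [hB]; exact div_nonpos_of_nonpos_of_nonneg (by linarith) hU.le
  have hcover : Ioo (-1:ℝ) 0 ⊆ (Iic A ∪ Ioc A B) ∪ Ioc B 0 := by
    rw [Iic_union_Ioc_eq_Iic hAB, Iic_union_Ioc_eq_Iic hB0]
    exact fun t ht => ht.2.le
  set f : ℝ → ℝ := fun x => 2 * √(1 - x ^ 2) with hf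
  have hfc : Continuous f := by rw [hf]; fun_prop
  -- piece 1: beyond the far edge the chord vanishes
  have h1 : ∫⁻ t in Iic A, F t = 0 := by
    refine le_antisymm ((setLIntegral_mono' measurableSet_Iic fun t ht => ?_).trans
      (by rw [lintegral_zero])) bot_le
    have ht0 : t ≤ 0 := le_trans ht (hAB.trans hB0)
    have htU : 1 + w' ≤ -t * U := by
      have : t * U ≤ A * U := mul_le_mul_of_nonneg_right ht hU.le
      rw [hA, div_mul_cancel₀ _ hU.ne'] at this
      linarith
    have hm : 1 ≤ max (‖t • windV U‖ - w') 0 := by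
      rw [norm_time_smul_windV hU ht0]
      exact le_max_of_le_left (by linarith)
    have : 1 ^ 2 - (max (‖t • windV U‖ - w') 0) ^ 2 ≤ 0 := by nlinarith
    rw [hF]
    simp only
    rw [Real.sqrt_eq_zero'.2 this, mul_zero, ENNReal.ofReal_zero]
  -- piece 2: the overlap band, chord ≤ 2
  have h2 : ∫⁻ t in Ioc B 0, F t ≤ ENNReal.ofReal (2 * w' / U) := by
    calc ∫⁻ t in Ioc B 0, F t ≤ ∫⁻ _ in Ioc B 0, (2 : ℝ≥0∞) :=
          setLIntegral_mono' measurableSet_Ioc fun t _ => by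
            rw [hF]
            simp only
            refine (ENNReal.ofReal_le_ofReal ?_).trans_eq (ENNReal.ofReal_ofNat 2)
            have : √(1 ^ 2 - (max (‖t • windV U‖ - w') 0) ^ 2) ≤ 1 :=
              calc √(1 ^ 2 - (max (‖t • windV U‖ - w') 0) ^ 2) ≤ √1 :=
                    Real.sqrt_le_sqrt (by nlinarith [sq_nonneg (max (‖t • windV U‖ - w') 0)])
                _ = 1 := Real.sqrt_one
            linarith
      _ = ENNReal.ofReal (2 * w' / U) := by
          rw [setLIntegral_const, Real.volume_Ioc,
            show 2 * w' / U = 2 * (0 - B) by rw [hB]; field_simp; ring,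
            ENNReal.ofReal_mul (by norm_num : (0:ℝ) ≤ 2), ENNReal.ofReal_ofNat]
  -- piece 3: the clean crossing, an exact quarter-disc computation
  have h3 : ∫⁻ t in Ioc A B, F t ≤ ENNReal.ofReal (π / 2 / U) := by
    have hwin : EqOn F (fun t => ENNReal.ofReal (f (-w' - U * t))) (Ioc A B) := by
      intro t ht
      have ht0 : t ≤ 0 := ht.2.trans hB0
      have hpos : 0 ≤ -t * U - w' := by
        have : t * U ≤ B * U := mul_le_mul_of_nonneg_right ht.2 hU.le
        rw [hB, div_mul_cancel₀ _ hU.ne'] at this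
        linarith
      rw [hF]
      simp only [hf, norm_time_smul_windV hU ht0, max_eq_left hpos]
      congr 3
      ring
    rw [setLIntegral_congr_fun measurableSet_Ioc hwin]
    have hgc : Continuous fun t => f (-w' - U * t) := hfc.comp (by fun_prop)
    have hint : IntegrableOn (fun t => f (-w' - U * t)) (Ioc A B) :=
      (hgc.continuousOn.integrableOn_Icc).mono_set Ioc_subset_Icc_self
    have hnn : 0 ≤ᵐ[volume.restrict (Ioc A B)] fun t => f (-w' - U * t) :=
      Eventually.of_forall fun t => by simp only [hf]; positivity
    rw [← ofReal_integral_eq_lintegral_ofReal hint hnn]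
    refine ENNReal.ofReal_le_ofReal (le_of_eq ?_)
    rw [← intervalIntegral.integral_of_le hAB, intervalIntegral.integral_comp_sub_mul f hU.ne' (-w')]
    have hlim1 : -w' - U * B = 0 := by rw [hB]; field_simp; ring
    have hlim2 : -w' - U * A = 1 := by rw [hA]; field_simp; ring
    rw [hlim1, hlim2, smul_eq_mul, hf, intervalIntegral.integral_const_mul,
      integral_sqrt_one_sub_sq_half]
    field_simp
    ring
  calc ∫⁻ t in Ioo (-1:ℝ) 0, F t ≤ ∫⁻ t in (Iic A ∪ Ioc A B) ∪ Ioc B 0, F t := lintegral_mono_set hcover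
    _ ≤ (∫⁻ t in Iic A, F t) + (∫⁻ t in Ioc A B, F t) + ∫⁻ t in Ioc B 0, F t :=
        (lintegral_union_le _ _ _).trans (add_le_add (lintegral_union_le _ _ _) le_rfl)
    _ ≤ 0 + ENNReal.ofReal (π / 2 / U) + ENNReal.ofReal (2 * w' / U) := by
        rw [h1]; gcongr
    _ = ENNReal.ofReal ((π / 2 + 2 * w') / U) := by
        rw [zero_add, ← ENNReal.ofReal_add (by positivity) (by positivity)]
        congr 1
        field_simp

end Summit.NavierStokesRegularity.NavierStokesRegularity.Theorems.Schatz2025
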